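import Summits.CriticalPhenomena.PercolationContinuityZ3.Theorems.Transplant.SkelPhiCellsWeakG
import Summits.CriticalPhenomena.PercolationContinuityZ3.Theorems.Transplant.PlanarCells2EfarN2S
import Summits.CriticalPhenomena.PercolationContinuityZ3.Theorems.Transplant.PlanarCells2SepInfS
import HarnessLib

/-!
# N2 (frames-only node `SamePDropOfSkeletonFrm₁`, OPEN), WAVE-1 Geom re-base ((R-22) K-G staggered centres, (R-27)/(R-29) far regions follow the
# neighbour): THE SCHEME GEOMETRY OF RECORD OVER `PCells2S` — `Skelφ.cellGeomSG₂S` and its `RunGeom/AnchGeom/SepGeom/SepGeom₂`, the `PCells2S` twin of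
# hp-8 g33's `SkelPhiCellsWeakG` §2–§3 (`cellGeomSG₂`)

builds on p205010 (kernel theorem, internal audit signed; external expert review pending) — nothing in this file uses p205010; nothing here is a
claim about the open node `SamePDropOfSkeletonFrm₁` (`SamePDropOfSkeletonNeg₁` is CLOSED in the tree and untouched by this file).
Lane `prim-bschramm`, seat `prim-hp-8` (gen 40); helper file (`--supports stmt-CriticalPhenomena-4575 --as helper`); design owner p3-g15 ((R-22), (R-27), (R-28),
(R-29); cover recipe 2026-08-22T22:41:51Z); planar inputs p5-g15's `PlanarCells2SDefs/SFar` and p3-g15's `PlanarCells2ContainS/SArm/SepS/SepInfS/LevelsS/EfarN2S`.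
WHAT CHANGES against `SkelPhiCellsWeakG` (everything else is its text with `P : PCells2S` and the boxes about the staggered centre `cenS`):
(1) the record **`cellGeomSG₂S`**: `Btw := VWin ψ (P.BtwNS v δ) rB` (the narrow arm of record, across half-width `5r⊥ − 1 − c δ.1`), `Efar := VWin ψ
    (P.FarNS₂ v δ) rE` — the SLACK TWO-BLOCK far region `BtwNS₂ v δ ∪ QNS v δ 2` (the far block follows the staggered neighbour `v + δ`), `col x :=
    {ψ = cenS x}`, stub profile `profS` read at the level about `cenS`;
(2) the cover `Efar ⊆ Btw ∪ Q (v+δ)` over a non-step map: g33's weak-step proof steps UP at the bottom row of a block and DOWN otherwise and never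
    crosses `15r∥ − 1 → 15r∥` downward, so every step's box lies in ONE block — `lev_bounds_of_mem_FarNS₂` hands out the across bound of the block the
    level selects, `upBox/downBox_subset_BtwNS` serve below `15r∥ − 1`, `upBox/downBox_subset_Q_add` from `15r∥` on;
(3) the stub cover `Stub ⊆ Q ∪ Btw` feeds the creep bound `c δ.1 ≤ r⊥` (`2r⊥ ≤ 5r⊥ − 2 − c`) to the up-box;
(4) disjointness / columns: `BtwNS_disjoint_BtwNS` (all pairs, J7), `EwvNS/Q/BtwNS_disjoint_FarNS` through `FarNS₂ ⊆ FarNS`, `cenS_not_mem_Cell/Zone`;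
(5) the radius schedule's well-formedness `WFS2` is a statement about NUMBERS (`r`, and `colQ` about `PCells2.cen` of the underlying `PCells2`) and is
    taken at `P.toPCells2` verbatim — at the root `cen 0 = cenS 0 = 0`.
* §1 `profS`, `exists_adj_upBoxS`, `exists_adj_downBoxS` (weak steps read at the level about `cenS`);
* §2 **`cellGeomSG₂S`**; §3 `runGeomSG₂S`, `anchGeomSG₂S`, **`sepGeomSG₂S (hlip) (hws) (hψ0) (hcol)`**, **`sepGeom₂SG₂S`**.  `ExitGeom/StepsGeom/LevelGeom/QSepGeom`
  are in the companion `SkelPhiCellsWeakGLevelsS` (400-line rule).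
[cite: KozmaNitzan2024, §4 pp. 25–27, 30–31 (Q_v, M_v, E_{v,x}, H^j_{v,x}, F^j_{v,x})] [cite: MartineauTassion2017, §4.3]
-/

noncomputable section

open scoped Classical

namespace Summit.CriticalPhenomena.PercolationContinuityZ3.Theorems

namespace Transplant

namespace Skelφ

open Literature.Probability.Percolation Literature.Probability.LatticeModels SimpleGraph KNCells
open Literature.Probability.Percolation.KozmaNitzan
open Literature.Probability.Percolation.KozmaNitzan.Cells (oth oth_ne sgOf sgOf_sign stepVec_apply_fst stepVec_apply_oth eq_oth_of_ne oth_oth)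
open Literature.Barriers.CriticalPhenomena (graphBall graphBall_finite mem_graphBall_self graphBall_mono)
open BoxProdZ2 (ConcRadiiG)
open PlanarSkeletonConc (mem_vspan_edgesIn_iff mem_vspan_edgesIn_of_adj)

variable {V : Type} [DecidableEq V] {G : SimpleGraph V} [G.LocallyFinite] {ψ : V → Site 2}

/-! ## §1 The stub profile and the two weak-step boxes, read about the staggered centre -/

/-- **The stub profile over staggered cells**: the corridor radius at the level of `t` about `cenS v` (twin of `prof`). [this work] -/
def profS (P : PCells2S) (Λ : ConcRadiiG) (a : ℕ) (v : Site 2) (δ : MDir) : Site 2 → ℕ := fun t => Λ.ρ a v δ (PCells2S.lev P δ v t)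

omit [DecidableEq V] [G.LocallyFinite] in
/-- **Up-box step** about the staggered centre: under `Lip` + `WeakSteps`, every vertex has a neighbour one planar level up-or-equal (level along `δ`
from `cenS v`) and transversally within one. [this work] -/
theorem exists_adj_upBoxS (hlip : Lip G ψ) (hws : WeakSteps G ψ) (P : PCells2S) (δ : MDir) (v : Site 2) (y : V) :
    ∃ m, G.Adj y m ∧ PCells2S.lev P δ v (ψ y) ≤ PCells2S.lev P δ v (ψ m) ∧ PCells2S.lev P δ v (ψ m) ≤ PCells2S.lev P δ v (ψ y) + 1 ∧
      |ψ m (oth δ.1) - ψ y (oth δ.1)| ≤ 1 := by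
  have hσ : ∃ σ : ℤˣ, (σ : ℤ) = sgOf δ := by
    rcases sgOf_sign δ with h | h
    · exact ⟨1, by simp [h]⟩
    · exact ⟨-1, by simp [h]⟩
  obtain ⟨σ, hσ⟩ := hσ
  obtain ⟨m, hadj, hm⟩ := hws y δ.1 σ
  obtain ⟨h0l, h0r⟩ := abs_le.1 (hlip hadj δ.1)
  rw [hσ] at hm
  refine ⟨m, hadj, ?_, ?_, by rw [abs_sub_comm]; exact hlip hadj (oth δ.1)⟩
  · unfold PCells2S.lev; rcases sgOf_sign δ with h | h <;> rw [h] at hm ⊢ <;> linarith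
  · unfold PCells2S.lev; rcases sgOf_sign δ with h | h <;> rw [h] <;> linarith

omit [DecidableEq V] [G.LocallyFinite] in
/-- **Down-box step** about the staggered centre: a neighbour one planar level down-or-equal and transversally within one. [this work] -/
theorem exists_adj_downBoxS (hlip : Lip G ψ) (hws : WeakSteps G ψ) (P : PCells2S) (δ : MDir) (v : Site 2) (y : V) :
    ∃ m, G.Adj y m ∧ PCells2S.lev P δ v (ψ m) ≤ PCells2S.lev P δ v (ψ y) ∧ PCells2S.lev P δ v (ψ y) - 1 ≤ PCells2S.lev P δ v (ψ m) ∧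
      |ψ m (oth δ.1) - ψ y (oth δ.1)| ≤ 1 := by
  have hσ : ∃ σ : ℤˣ, (σ : ℤ) = -sgOf δ := by
    rcases sgOf_sign δ with h | h
    · exact ⟨-1, by simp [h]⟩
    · exact ⟨1, by simp [h]⟩
  obtain ⟨σ, hσ⟩ := hσ
  obtain ⟨m, hadj, hm⟩ := hws y δ.1 σ
  obtain ⟨h0l, h0r⟩ := abs_le.1 (hlip hadj δ.1)
  rw [hσ] at hm
  refine ⟨m, hadj, ?_, ?_, by rw [abs_sub_comm]; exact hlip hadj (oth δ.1)⟩
  · unfold PCells2S.lev; rcases sgOf_sign δ with h | h <;> rw [h] at hm ⊢ <;> linarith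
  · unfold PCells2S.lev; rcases sgOf_sign δ with h | h <;> rw [h] <;> linarith

variable (G ψ)

/-! ## §2 The record over staggered cells -/

/-- **The concentric cell geometry over a (non-step) planar map, two units, STAGGERED centres** (anchor type `ℕ` = depth, rule `a ↦ a + 1`,
admissible `{a, a+1}`): every region is the vertex span of a window over a planar box about `cenS`, with the radius schedule `Λ`; the between-box is
the narrow arm `BtwNS` of record, the far region the slack two-block `FarNS₂ = BtwNS₂ ∪ QNS v δ 2` (the far block about the staggered neighbour).
[cite: KozmaNitzan2024, §4 pp. 25–26 (Q_v, M_v, E_{v,x}, H^j_{v,x})] -/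
def cellGeomSG₂S (P : PCells2S) (w₀ : V) (Λ : ConcRadiiG) : CellGeom V ℕ where
  K := P.K
  root := w₀
  a₀ := 0
  Q := fun a v => VWin G ψ w₀ (PCells2S.Q P v) (Λ.rQ a v)
  M := fun a v => VWin G ψ w₀ (PCells2S.M P v) (Λ.rM a v)
  Cell := fun a v => VWin G ψ w₀ (PCells2S.Cell P v) (Λ.rC a v)
  Btw := fun a v δ => VWin G ψ w₀ (PCells2S.BtwNS P v δ) (Λ.rB a v δ)
  Efar := fun a v δ => VWin G ψ w₀ (PCells2S.FarNS₂ P v δ) (Λ.rE a v δ)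
  Stub := fun a v δ j => VStair G ψ w₀ (PCells2S.Stub P v δ j) (profS P Λ a v δ)
  Zone := fun a v δ => VWin G ψ w₀ (PCells2S.Zone P v δ) (Λ.rB a v δ)
  col := fun x => {y | ψ y = PCells2S.cenS P x}
  anchor := fun a _ _ => a + 1
  anchSet := fun a _ => {a, a + 1}
  anchor_mem := fun a _ _ => Finset.mem_insert_of_mem (Finset.mem_singleton_self _)
  stub_mono := fun _ v δ _ _ h => VStair_mono (P.Stub_mono v δ h) fun _ _ => le_rfl
  hK := by have := P.hK; omega

variable {G ψ}

section Records

variable (P : PCells2S) (w₀ : V) {Λ : ConcRadiiG} (hΛ : WFS2 P.toPCells2 Λ) (hψ0 : ψ w₀ = 0)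

/-! ## §3 `RunGeom`, `AnchGeom`, `SepGeom`, `SepGeom₂` -/

/-- **`RunGeom` — automatic for spans.** [folklore] -/
theorem runGeomSG₂S : RunGeom G (cellGeomSG₂S G ψ P w₀ Λ) where
  adjQ _ _ _ hy := exists_adj_of_mem_VWin hy
  adjBtw _ _ _ _ hy := exists_adj_of_mem_VWin hy
  adjStub _ _ _ _ _ _ hy := exists_adj_of_mem_VStair hy

/-- `AnchGeom`. [folklore] -/
theorem anchGeomSG₂S : AnchGeom (cellGeomSG₂S G ψ P w₀ Λ) where
  refl a _ := Finset.mem_insert_self a {a + 1}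
  const _ _ _ := rfl

include hΛ hψ0 in
/-- **`SepGeom` over staggered cells** for a 1-Lipschitz window map with WEAK steps: covers across a shared level by the margin method, covers across
abutting levels by a weak step into a slack box OF THE SAME BLOCK, disjointness / separation planar about `cenS`; the column point is the hypothesis
`hcol`. [cite: KozmaNitzan2024, §4 pp. 26–29] -/
theorem sepGeomSG₂S (hlip : Lip G ψ) (hws : WeakSteps G ψ) (hcol : ∀ a x, ∃ y ∈ VWin G ψ w₀ (PCells2S.Q P x) (Λ.rQ a x), ψ y = PCells2S.cenS P x) :
    SepGeom G (cellGeomSG₂S G ψ P w₀ Λ) where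
  anch_refl a _ := Finset.mem_insert_self a {a + 1}
  root_mem := by
    change w₀ ∈ VWin G ψ w₀ (P.Q 0) (Λ.rQ 0 0)
    obtain ⟨m, hadj, -⟩ := hws w₀ 0 1
    have hQ : ∀ s : Site 2, (∀ i, |s i| ≤ 1) → s ∈ P.Q 0 := fun s hs => by
      rw [PCells2S.Q, PCells2S.mem_aboxS_iff]
      intro i
      have := abs_le.1 (hs i); have := P.one_le_r i
      simp only [PCells2S.cenS_apply, Pi.zero_apply, mul_zero, add_zero]; push_cast; constructor <;> omega
    refine root_mem_VWin_of_adj (le_trans (by omega) (hΛ.colQ 0 0)) (hQ _ fun i => by rw [hψ0]; simp) hadj (hQ _ fun i => ?_)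
    have := hlip hadj i; rw [hψ0, Pi.zero_apply, zero_sub, abs_neg] at this; exact this
  Q_subset_Cell a v := VWin_mono (P.Q_subset_Cell v) (hΛ.QC a a v (ConcRadiiG.WF.mem_self a))
  Btw_subset_Cells a a' v δ ha' := by
    change VWin G ψ w₀ (P.BtwNS v δ) (Λ.rB a' v δ) ⊆ VWin G ψ w₀ (P.Cell v) (Λ.rC a v) ∪ VWin G ψ w₀ (P.Cell (v + stepVec δ)) (Λ.rC a' (v + stepVec δ))
    exact VWin_subset_union_of_margin hlip (P.adjMargin_BtwNS_Cells v δ) (hΛ.BC a a' v δ ha') (hΛ.BC' a' a' v δ (ConcRadiiG.WF.mem_self a'))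
  Stub_subset_Q_union_Btw a a' v δ j ha' hj := by
    intro y hy
    change y ∈ VStair G ψ w₀ (P.Stub v δ j) (profS P Λ a' v δ) at hy
    change y ∈ VWin G ψ w₀ (P.Q v) (Λ.rQ a v) ∪ VWin G ψ w₀ (P.BtwNS v δ) (Λ.rB a' v δ)
    obtain ⟨hP, hd⟩ := mem_of_mem_VStair hy
    have hjK : j < P.K := by change j + 1 ≤ P.K at hj; omega
    obtain ⟨htr, hl, hu⟩ := P.bounds_of_mem_Stub hjK hP
    have hs1 : (1 : ℤ) ≤ P.s δ.1 := by exact_mod_cast P.hs δ.1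
    have hr1 : (1 : ℤ) ≤ P.r (oth δ.1) := by exact_mod_cast P.one_le_r (oth δ.1)
    have hc := P.c_nonneg δ.1
    have hc' := P.c_le_r_oth δ
    by_cases hlev : P.lev δ v (ψ y) ≤ 5 * P.r δ.1
    · -- down-step into the cube
      obtain ⟨m, hadj, h1, h2, h3⟩ := exists_adj_downBoxS hlip hws P δ v y
      have hyQ : ψ y ∈ P.Q v := P.downBox_subset_Q (htr.trans (by omega)) (by omega) hlev le_rfl (by omega) (by simp)
      have hmQ : ψ m ∈ P.Q v := P.downBox_subset_Q (htr.trans (by omega)) (by omega) hlev h1 h2 h3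
      exact Finset.mem_union_left _ (mem_VWin_of_adj hd (hΛ.ρQ1 a a' v δ _ ha' hlev) hyQ hadj hmQ)
    · -- up-step into the narrow arm (`2r⊥ ≤ 5r⊥ − 2 − c` as `c ≤ r⊥`)
      obtain ⟨m, hadj, h1, h2, h3⟩ := exists_adj_upBoxS hlip hws P δ v y
      have hyB : ψ y ∈ P.BtwNS v δ := P.upBox_subset_BtwNS (htr.trans (by omega)) (by omega) (by omega) le_rfl (by omega) (by simp)
      have hmB : ψ m ∈ P.BtwNS v δ := P.upBox_subset_BtwNS (htr.trans (by omega)) (by omega) (by omega) h1 h2 h3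
      exact Finset.mem_union_right _ (mem_VWin_of_adj hd (hΛ.ρB1 a' v δ _) hyB hadj hmB)
  Stub_subset_Cell_union_Zone a a' v δ j ha' hj := by
    change VStair G ψ w₀ (P.Stub v δ j) (profS P Λ a' v δ) ⊆ VWin G ψ w₀ (P.Cell v) (Λ.rC a v) ∪ VWin G ψ w₀ (P.Zone v δ) (Λ.rB a' v δ)
    have hjK : j < P.K := by change j + 1 ≤ P.K at hj; omega
    exact VStair_subset_union_of_margin hlip (P.adjMargin_Stub_Cell_Zone v δ hjK) (fun t _ => hΛ.ρC v δ _ ha') (fun t _ => hΛ.ρB a' v δ _)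
  Efar_subset_Btw_union_Q a v δ := by
    intro y hy
    change y ∈ VWin G ψ w₀ (P.FarNS₂ v δ) (Λ.rE a v δ) at hy
    change y ∈ VWin G ψ w₀ (P.BtwNS v δ) (Λ.rB a v δ) ∪ VWin G ψ w₀ (P.Q (v + stepVec δ)) (Λ.rQ a (v + stepVec δ))
    have hd := mem_graphBall_of_mem_VWin hy
    have hf := φ_mem_of_mem_VWin hy
    obtain ⟨hl, hu, hlo, hhi⟩ := P.lev_bounds_of_mem_FarNS₂ hf
    have hr : (1 : ℤ) ≤ P.r δ.1 := by exact_mod_cast P.one_le_r δ.1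
    by_cases hlev : P.lev δ v (ψ y) ≤ 15 * P.r δ.1 - 1
    · -- the between block: up from the bottom row, down otherwise
      refine Finset.mem_union_left _ ?_
      have htr := hlo hlev
      by_cases hbot : P.lev δ v (ψ y) = 5 * P.r δ.1 + 1
      · obtain ⟨m, hadj, h1, h2, h3⟩ := exists_adj_upBoxS hlip hws P δ v y
        have hyB : ψ y ∈ P.BtwNS v δ := P.upBox_subset_BtwNS htr hl (by omega) le_rfl (by omega) (by simp)
        have hmB : ψ m ∈ P.BtwNS v δ := P.upBox_subset_BtwNS htr hl (by omega) h1 h2 h3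
        exact mem_VWin_of_adj hd (hΛ.EB1 a v δ) hyB hadj hmB
      · obtain ⟨m, hadj, h1, h2, h3⟩ := exists_adj_downBoxS hlip hws P δ v y
        have hyB : ψ y ∈ P.BtwNS v δ := P.downBox_subset_BtwNS htr (by omega) hlev le_rfl (by omega) (by simp)
        have hmB : ψ m ∈ P.BtwNS v δ := P.downBox_subset_BtwNS htr (by omega) hlev h1 h2 h3
        exact mem_VWin_of_adj hd (hΛ.EB1 a v δ) hyB hadj hmB
    · -- the neighbour's block: down from the top row, up otherwise
      refine Finset.mem_union_right _ ?_
      have htr : |ψ y (oth δ.1) - P.cenS (v + stepVec δ) (oth δ.1)| ≤ 5 * P.r (oth δ.1) - 1 := (hhi (by omega)).trans (by omega)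
      by_cases htop : P.lev δ v (ψ y) = 25 * P.r δ.1
      · obtain ⟨m, hadj, h1, h2, h3⟩ := exists_adj_downBoxS hlip hws P δ v y
        have hyQ : ψ y ∈ P.Q (v + stepVec δ) := P.downBox_subset_Q_add htr (by omega) hu le_rfl (by omega) (by simp)
        have hmQ : ψ m ∈ P.Q (v + stepVec δ) := P.downBox_subset_Q_add htr (by omega) hu h1 h2 h3
        exact mem_VWin_of_adj hd (hΛ.EQ1 a v δ) hyQ hadj hmQ
      · obtain ⟨m, hadj, h1, h2, h3⟩ := exists_adj_upBoxS hlip hws P δ v y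
        have hyQ : ψ y ∈ P.Q (v + stepVec δ) := P.upBox_subset_Q_add htr (by omega) (by omega) le_rfl (by omega) (by simp)
        have hmQ : ψ m ∈ P.Q (v + stepVec δ) := P.upBox_subset_Q_add htr (by omega) (by omega) h1 h2 h3
        exact mem_VWin_of_adj hd (hΛ.EQ1 a v δ) hyQ hadj hmQ
  Ewv_disjoint_Efar a a' w δw du hdu := by
    change Disjoint (VWin G ψ w₀ (P.BtwNS w δw) (Λ.rB a w δw) ∪ VWin G ψ w₀ (P.Q (w + stepVec δw)) (Λ.rQ a (w + stepVec δw)))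
      (VWin G ψ w₀ (P.FarNS₂ (w + stepVec δw) du) (Λ.rE a' (w + stepVec δw) du))
    have h := (P.EwvNS_disjoint_FarNS w hdu).mono_right (P.FarNS₂_subset_FarNS _ _)
    rw [PCells2S.EwvNS, Finset.disjoint_union_left] at h
    rw [Finset.disjoint_union_left]
    exact ⟨disjoint_VWin h.1 _ _, disjoint_VWin h.2 _ _⟩
  Q_disjoint_Q a a' u x hux := disjoint_VWin (P.Q_disjoint_Q hux) _ _
  Q_disjoint_Btw a a' x v δ := disjoint_VWin (P.Q_disjoint_BtwNS x v δ) _ _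
  Btw_disjoint_Btw a a' v δ v' δ' h1 h2 := disjoint_VWin (P.BtwNS_disjoint_BtwNS h1 h2) _ _
  Q_disjoint_Efar a a' v δ := disjoint_VWin ((P.Q_disjoint_FarNS v δ).mono_right (P.FarNS₂_subset_FarNS _ _)) _ _
  Btw_disjoint_Efar a a' v δ δ' h := disjoint_VWin ((P.BtwNS_disjoint_FarNS v h).mono_right (P.FarNS₂_subset_FarNS _ _)) _ _
  col_Q a x := by
    obtain ⟨y, hy, hcy⟩ := hcol a x
    exact ⟨y, hy, hcy⟩
  col_Cell a u x hux y hy hcol' := by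
    change ψ y = P.cenS x at hcol'
    exact P.cenS_not_mem_Cell hux (hcol' ▸ φ_mem_of_mem_VWin hy)
  col_Zone a u δ x y hy hcol' := by
    change ψ y = P.cenS x at hcol'
    exact P.cenS_not_mem_Zone u δ x (hcol' ▸ φ_mem_of_mem_VWin hy)

include hΛ hψ0 in
/-- **`SepGeom₂` over staggered cells** (cross-anchor containments), by the margin method. [cite: KozmaNitzan2024, §4 pp. 25–26] -/
theorem sepGeom₂SG₂S (hlip : Lip G ψ) (hws : WeakSteps G ψ) (hcol : ∀ a x, ∃ y ∈ VWin G ψ w₀ (PCells2S.Q P x) (Λ.rQ a x), ψ y = PCells2S.cenS P x) :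
    SepGeom₂ G (cellGeomSG₂S G ψ P w₀ Λ) where
  toSepGeom := sepGeomSG₂S P w₀ hΛ hψ0 hlip hws hcol
  Q_subset_Cell₂ a a' x ha' := VWin_mono (P.Q_subset_Cell x) (hΛ.QC a a' x ha')
  Btw_subset_Cells₂ a a' v δ ha' := by
    change VWin G ψ w₀ (P.BtwNS v δ) (Λ.rB a v δ) ⊆ VWin G ψ w₀ (P.Cell v) (Λ.rC a v) ∪ VWin G ψ w₀ (P.Cell (v + stepVec δ)) (Λ.rC a' (v + stepVec δ))
    exact VWin_subset_union_of_margin hlip (P.adjMargin_BtwNS_Cells v δ) (hΛ.BC a a v δ (ConcRadiiG.WF.mem_self a)) (hΛ.BC' a a' v δ ha')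

end Records

end Skelφ

end Transplant

end Summit.CriticalPhenomena.PercolationContinuityZ3.Theorems

end
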